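import Summits.BirchSwinnertonDyer.BirchSwinnertonDyer.Theorems.KolyvaginRoadThreeMethod2RankLoweringGood
import Summits.BirchSwinnertonDyer.BirchSwinnertonDyer.Theorems.KolyvaginRoadThreeMethod2IsoLocalDuality
import Summits.BirchSwinnertonDyer.BirchSwinnertonDyer.Theorems.KolyvaginRoadThreeMethod2IsoOrdinary
import Summits.BirchSwinnertonDyer.BirchSwinnertonDyer.Theorems.KolyvaginRoadThreeMethod2LocalH0
import Literature.NumberTheory.EllipticCurves.LocalKummerIsotropyTransport
import Literature.NumberTheory.EllipticCurves.KummerImageIsotropyProofs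
import HarnessLib

/-!
# Route `KolyvaginRoadThree`, deciding crux `ZhangSharpFrameAtThreeHL` (item stmt-BirchSwinnertonDyer-19574):
# stub `stub_levelRaisingAtThree` (v2x) — the inputs (Iso) and (Line) DISCHARGED in the kernel (modulo (H0)
# `h⁰(K_w, E[3]) ≤ 1`, itself PROVED in `…Method2LocalH0.lean`); the stub from (Cheb) + (Equiv) + (Trans) alone
# (cell `bsd-stepL`, seat `bsd-stepL-koly` g13, OWNER of the METHOD line; `--supports stmt-BirchSwinnertonDyer-19574`, helper)

WHY THIS FILE. koly3a's `Method2.stub_levelRaisingAtThree_v2w_of_localGlobal` (p467211) proves the REGISTERED stub A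
text of the v2x skeleton from five inputs at good unipotent-admissible primes: (Cheb) sign-refined Čebotarev,
(Equiv) the sign of complex conjugation on `H¹(K_q, E[3])`, (Line) the Kummer image at `q` is a line, (Trans) Kummer ∩
ordinary `= 0`, and (Iso) — the Poitou–Tate see-saw, the one GLOBAL input, "with no tree supplier" (koly g12 HANDOFF).
Here (Iso) and (Line) are PROVED, first from the single LOCAL hypothesis

  (H0) `#(E[3](K̄)|_{Γ_{K_w}})^{Γ_{K_w}} ≤ 3` at the place `w` of every GOOD unipotent-admissible prime

(koly MEMO-v8 §2: `h⁰(K_w, E[3]) = 1`, `Frob_w = u²` unipotent `≠ 1`; equivalently `#E(K_w)[3] ≤ 3` by the tree's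
`natCard_invariants_torsion_restrictField`), using only PROVED tree theorems (siblings `…Method2IsoLocalDuality.lean`,
`…Method2IsoOrdinary.lean`: Tate's reciprocity law for the totally complex `K`, local Tate duality for `E[3]`, the
prime-to-`3` Euler characteristic, the discharged Kummer isotropy, `e(L₀, L₀) = 0` on the ordinary lines), and then
UNCONDITIONALLY, (H0) being itself a theorem of the sibling `…Method2LocalH0.lean`
(`natCard_invariants_le_three_of_frobSqNeOneAt`: the skeleton's `FrobSqNeOneAt` transported to the local Galois group
by the tree's Gross-1991 local–global machinery):
* `hiso_of_h0` — (Iso) VERBATIM (koly3a's binder: `SelRelQ W K c (insert q n) {q} μ` at the place of `q`, good `n`,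
  good `q ∉ n`, `torsionLocMap` model) ⟸ (H0). Proof: for `y, z` in the relaxed space the local Weil terms vanish at
  every place `w ≠ v_q` — Kummer isotropy at the infinite places and at the finite places below no level prime, the
  ordinary isotropy at the places of `n` (the place of `q` is `v_q`, `q` being inert) — so by Poitou–Tate the image at
  `v_q` is isotropic in `H¹(K_{v_q}, E[3])`, of order `≤ 9` by (H0), hence a line;
* `hline_of_h0` — (Line) VERBATIM ⟸ (H0) (ANY number field `K`): the local Kummer condition `𝓛_v` is isotropic
  (Poonen–Rains, discharged) inside `H¹(K_v, E[3])` of order `≤ 9`, hence a line;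
* `hiso`, `hline` — (Iso) and (Line) VERBATIM with NO extra hypothesis at an imaginary quadratic `K` (the frame's
  `IsImaginaryQuadratic K`), from the two theorems above and the proved (H0);
* `stub_levelRaisingAtThree_of_cheb_equiv_trans` — the REGISTERED v2x text of `stub_levelRaisingAtThree` VERBATIM ⟸
  frame-wise (Cheb) ∧ (Equiv) ∧ (Trans) (koly3a's `selQ_rankLowering_on_of_localGlobal` fed with `hline`, `hiso`).
NET: of koly3a's five inputs, (Iso) [the GLOBAL one] and (Line) are now in the kernel; stub A's remaining inputs are
(Equiv) [the sign of `τ` on `H¹(K_q, E[3])`, MEMO-v8 §2(e)], (Trans) [`H¹_fin ∩ H¹_ord = 0`, MEMO-v8 §2(c)] — LOCAL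
statements at ONE good unipotent-admissible prime — and (Cheb) [sign-refined Čebotarev, MEMO-v8 §4].

HONEST FRAMING: theorems only; no definition, no named fact, no `sorry`; the stub is NOT proved ((Cheb), (Equiv),
(Trans) remain hypotheses); nothing is booked. PARTITION: O2@3 (B10) × A1 (1 116 TRUE-OPEN; cw 248 943) × crux 19574
× 3 ∥ N — types-the-object-of (kernel discharge of two of the five inputs of a registered stub); closes: none (T7).

References: [cite: WZhang2014, Prop. 5.4, Lemma 7.3, §9 (9.1)–(9.3)] [cite: BertoliniDarmon2005, Lemma 2.6, §2.2–§2.3]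
[cite: MilneADT2006, Ch. I, Cor. 2.3, Thm. 2.8, Thm. 4.10(b)] [cite: PoonenRains2012, Prop. 4.8, Cor. 4.6].
-/

noncomputable section

open scoped Classical

namespace Summit.BirchSwinnertonDyer.Rank1Residual.X11b.Three.Koly.Method2.Iso

open CategoryTheory WeierstrassCurve Field Function NumberField IsDedekindDomain
open Literature.NumberTheory.EllipticCurves Literature.NumberTheory.EllipticCurves.ModularForms
  Literature.NumberTheory.GaloisRepresentations Module
open Literature.NumberTheory.GaloisRepresentations.DiscreteGaloisModule (mu MuCarrier)
open Literature.NumberTheory.GaloisCohomology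
open scoped ContRepresentation

-- Cup products need `LocallyCompactSpace Γ`; as in the tree's cup-product files, the compactness of
-- absolute Galois groups is a local instance only; `E[n]` finite for the Tate-dual bookkeeping.
attribute [local instance] absoluteGaloisGroup_compactSpace
attribute [local instance] finite_geomTorsion_of_neZero

section Method2

open Summit.BirchSwinnertonDyer.Rank1Residual.X11b.Three.Koly.Method2

variable (W : WeierstrassCurve ℚ) (K : Type) [Field K] [NumberField K] (c : K ≃ₐ[ℚ] K)
variable [W.IsElliptic] [W.IsGloballyMinimal] [Module (ZMod 3) (V3 W K)]

/-- **(Iso) from (H0).** The input (Iso) of `Method2.selQ_rankLowering_on_of_localGlobal` ∕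
`stub_levelRaisingAtThree_v2w_of_localGlobal` (koly3a p464695 ∕ p467211) VERBATIM — on a good level `n`, at a good
unipotent-admissible `q ∉ n` with place `v`, the `torsionLocMap`-localisations at `v` of two classes of the
`q`-relaxed space `SelRelQ (insert q n) {q} μ` are proportional — from (H0): `#(E[3](K̄)|_{Γ_{K_w}})^{Γ_{K_w}} ≤ 3`
at the place `w` of every GOOD unipotent-admissible prime. Proof (W. Zhang Prop. 5.4 at `p = 3`; koly MEMO-v8 §5):
the local Weil terms of two classes of the relaxed space vanish at every place `w ≠ v` (Kummer isotropy at the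
infinite places and at the finite places under no level prime; `e(L₀, L₀) = 0` at the places of `n`
(`weilCupProduct_res_eq_zero_of_mem_ordinaryLocalKer` + (H0)); the place of the inert `q` is `v`), so by Tate's
reciprocity law for the totally complex `K` (`exists_zsmul_localization_of_forall_ne`) the image at `v` is isotropic
in `H¹(K_v, E[3])`, which has order `≤ 9` by (H0) (`natCard_galoisCohomology_one_torsion_le_sq`), hence is a line;
transported to the `torsionLocMap` model by `exists_addMonoidHom_comp_localization_eq_torsionLocMap`. CONDITIONAL on
(H0) only. [cite: WZhang2014, Prop. 5.4, §9 (9.1)–(9.2)] [cite: MilneADT2006, Ch. I, Thm. 4.10(b)] -/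
theorem hiso_of_h0 (hK : IsImaginaryQuadratic K)
    (h0 : ∀ q : {q // IsUAdmissiblePrime W K q}, FrobSqNeOneAt W 3 q.1 →
      ∀ w : HeightOneSpectrum (𝓞 K), ((q : ℕ) : 𝓞 K) ∈ w.asIdeal →
        Nat.card (GaloisRep.restrictField (w.adicCompletion K)
          ((W.baseChange K).torsionGaloisModule ((3 ^ 1 : ℕ) : ℤ))).toTopRep.ρ.invariants ≤ 3) :
    ∀ (n : Finset {q // IsUAdmissiblePrime W K q}) (q : {q // IsUAdmissiblePrime W K q}) (μ : Bool),
      GoodLevel W K n → FrobSqNeOneAt W 3 q.1 → q ∉ n →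
      ∀ v : HeightOneSpectrum (𝓞 K), ((q : ℕ) : 𝓞 K) ∈ v.asIdeal →
      ∀ y ∈ SelRelQ W K c (insert q n) {q} μ, ∀ z ∈ SelRelQ W K c (insert q n) {q} μ,
        (W.baseChange K).torsionLocMap (v.adicCompletion K) ((3 ^ 1 : ℕ) : ℤ) z ≠ 0 →
        ∃ a : ℤ, (W.baseChange K).torsionLocMap (v.adicCompletion K) ((3 ^ 1 : ℕ) : ℤ) y =
          a • (W.baseChange K).torsionLocMap (v.adicCompletion K) ((3 ^ 1 : ℕ) : ℤ) z := by
  intro n q μ hgood hq hqn v hv y hy z hz hz0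
  haveI : IsTotallyComplex K := hK.2
  haveI : Fact (Nat.Prime (3 ^ 1)) := ⟨by norm_num⟩
  haveI : PerfectField K := PerfectField.ofCharZero
  have h3Z : ((3 ^ 1 : ℕ) : ℤ) ≠ 0 := by norm_num
  obtain ⟨e, hμ, hadd₁, hadd₂, halt, hnondeg, hgal⟩ :=
    exists_weilPairing_holds (W.baseChange K) (3 ^ 1) (by norm_num) (by norm_num)
  -- the place above the inert prime `q` is unique
  have hq0 : (q : ℕ) ≠ 0 := q.2.1.ne_zero
  have hqP : (Ideal.span {((q : ℕ) : 𝓞 K)}).IsPrime := q.2.2.2.2.2.1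
  have huniq : ∀ w : HeightOneSpectrum (𝓞 K), ((q : ℕ) : 𝓞 K) ∈ w.asIdeal → w = v :=
    fun w hw ↦ placesAbove_eq_of_isPrime_span K hqP hq0 hv hw
  -- `v ∤ 3` (`q ≠ 3` is prime and `q ∈ v`)
  have h3v : ((3 ^ 1 : ℕ) : 𝓞 K) ∉ v.asIdeal := by
    intro h3
    have hcop : Nat.Coprime (q : ℕ) 3 :=
      (Nat.coprime_primes q.2.1 Nat.prime_three).mpr q.2.2.2.2.1
    obtain ⟨a, b, hab⟩ := (Nat.isCoprime_iff_coprime.mpr hcop : IsCoprime ((q : ℕ) : ℤ) (3 : ℤ))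
    apply v.isPrime.ne_top
    rw [Ideal.eq_top_iff_one]
    have h1 : (1 : 𝓞 K) = (a : 𝓞 K) * ((q : ℕ) : 𝓞 K) + (b : 𝓞 K) * ((3 ^ 1 : ℕ) : 𝓞 K) := by
      rw [pow_one]
      exact_mod_cast congrArg (fun t : ℤ => (t : 𝓞 K)) hab.symm
    rw [h1]
    exact v.asIdeal.add_mem (v.asIdeal.mul_mem_left _ hv) (v.asIdeal.mul_mem_left _ h3)
  -- `#H¹(K_v, E[3]) ≤ 9`
  have hcard := natCard_galoisCohomology_one_torsion_le_sq (W.baseChange K) (3 ^ 1) v h3v (h0 q hq v hv)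
  -- the comparison `Φ ∘ loc_v = torsionLocMap` between the two models of `H¹(K_v, E[3])`
  obtain ⟨Φ, hΦ⟩ := exists_addMonoidHom_comp_localization_eq_torsionLocMap (W.baseChange K) (3 ^ 1) v
  -- membership in the relaxed level-raised space, unpacked
  have hmem : ∀ x ∈ SelRelQ W K c (insert q n) {q} μ,
      (∀ w : InfinitePlace K,
        x ∈ selmerLocalKer (W.baseChange K) w.Completion ((3 ^ 1 : ℕ) : ℤ)) ∧
      (∀ w : HeightOneSpectrum (𝓞 K), (∀ q' ∈ insert q n, ((q' : ℕ) : 𝓞 K) ∉ w.asIdeal) →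
        x ∈ selmerLocalKer (W.baseChange K) (w.adicCompletion K) ((3 ^ 1 : ℕ) : ℤ)) ∧
      (∀ q' ∈ n, ∀ w : HeightOneSpectrum (𝓞 K), ((q' : ℕ) : 𝓞 K) ∈ w.asIdeal →
        x ∈ (W.baseChange K).ordinaryLocalKer (w.adicCompletion K) ((3 ^ 1 : ℕ) : ℤ)) := by
    intro x hx
    change x ∈ levelSelmerSubgroup W K c _ _ μ at hx
    simp only [levelSelmerSubgroup, AddSubgroup.mem_inf, AddSubgroup.mem_iInf] at hx
    obtain ⟨-, hinf, hfin, hord⟩ := hx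
    refine ⟨hinf, fun w hw ↦ hfin w fun q'' hq'' ↦ ?_, fun q' hq' w hw ↦ hord q' ⟨?_, ?_⟩ w hw⟩
    · rcases hq'' with hq'' | hq''
      · rw [Finset.mem_coe, Finset.mem_image] at hq''
        obtain ⟨a, ha, rfl⟩ := hq''
        exact hw a ha
      · obtain ⟨a, ha, rfl⟩ := hq''
        rw [Set.mem_singleton_iff] at ha
        subst ha
        exact hw a (Finset.mem_insert_self _ _)
    · exact Finset.mem_image.mpr ⟨q', Finset.mem_insert_of_mem hq', rfl⟩
    · rintro ⟨a, ha, haq⟩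
      rw [Set.mem_singleton_iff] at ha
      subst ha
      exact hqn (Subtype.ext haq ▸ hq')
  -- the local Weil terms of two classes of the relaxed space vanish at every place `w ≠ v`
  have hA : ∀ y ∈ (SelRelQ W K c (insert q n) {q} μ).toAddSubgroup,
      ∀ z ∈ (SelRelQ W K c (insert q n) {q} μ).toAddSubgroup, ∀ w : Place K, w ≠ Sum.inr v →
      (weilContPairingLocal (W.baseChange K) (3 ^ 1) e hμ hadd₁ hadd₂ hgal w).cupProduct
        (galoisCohomology.localization ((W.baseChange K).torsionGaloisModule ((3 ^ 1 : ℕ) : ℤ)) w 1 y)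
        (galoisCohomology.localization ((W.baseChange K).torsionGaloisModule ((3 ^ 1 : ℕ) : ℤ)) w 1 z)
        = 0 := by
    intro y hy z hz w hw
    obtain ⟨hyinf, hyfin, hyord⟩ := hmem y hy
    obtain ⟨hzinf, hzfin, hzord⟩ := hmem z hz
    -- Kummer isotropy at a place where both classes satisfy the Kummer condition
    have hKum : ∀ w : Place K,
        y ∈ selmerLocalKer (W.baseChange K) (Place.Completion w) ((3 ^ 1 : ℕ) : ℤ) →
        z ∈ selmerLocalKer (W.baseChange K) (Place.Completion w) ((3 ^ 1 : ℕ) : ℤ) →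
        (weilContPairingLocal (W.baseChange K) (3 ^ 1) e hμ hadd₁ hadd₂ hgal w).cupProduct
          (galoisCohomology.localization ((W.baseChange K).torsionGaloisModule ((3 ^ 1 : ℕ) : ℤ)) w 1 y)
          (galoisCohomology.localization ((W.baseChange K).torsionGaloisModule ((3 ^ 1 : ℕ) : ℤ)) w 1 z)
          = 0 := by
      intro w hyw hzw
      rw [← comap_localization_kummerSelmerStructure] at hyw hzw
      exact (W.baseChange K).cupProduct_eq_zero_of_mem_kummerSelmerStructure_of_fact (3 ^ 1) e h3Z w
        (kummerClass_cupProduct_kummerClass_eq_zero_holds _) hμ hadd₁ hadd₂ halt hgal hyw hzw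
    rcases w with w | w
    · -- infinite place: Kummer on both sides
      exact hKum (Sum.inl w) (hyinf w) (hzinf w)
    · have hwv : w ≠ v := fun h ↦ hw (by rw [h])
      by_cases hex : ∃ q' ∈ insert q n, ((q' : ℕ) : 𝓞 K) ∈ w.asIdeal
      · -- a level prime below `w`: it is in `n` (the place of `q` is `v`), both classes are ordinary
        obtain ⟨q', hq', hq'w⟩ := hex
        rcases Finset.mem_insert.mp hq' with rfl | hq'n
        · exact absurd (huniq w hq'w) hwv
        · exact weilCupProduct_res_eq_zero_of_mem_ordinaryLocalKer (W.baseChange K) (3 ^ 1)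
            (w.adicCompletion K) e hμ hadd₁ hadd₂ hgal
            (weilPairingHom_eq_zero_of_invariant_of_card_le (W.baseChange K) (3 ^ 1) (w.adicCompletion K)
              e hμ hadd₁ hadd₂ halt (h0 q' (hgood q' hq'n) w hq'w))
            (hyord q' hq'n w hq'w) (hzord q' hq'n w hq'w)
      · -- no level prime below `w`: Kummer on both sides
        push Not at hex
        exact hKum (Sum.inr w) (hyfin w hex) (hzfin w hex)
  -- Poitou–Tate at `v`
  have hz0' : galoisCohomology.localization ((W.baseChange K).torsionGaloisModule ((3 ^ 1 : ℕ) : ℤ))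
      (Sum.inr v) 1 z ≠ 0 := fun h ↦ hz0 (by rw [← hΦ z, h]; exact map_zero Φ)
  obtain ⟨a, ha⟩ := exists_zsmul_localization_of_forall_ne (W.baseChange K) (3 ^ 1) e hμ hadd₁ hadd₂ hgal
    v hnondeg hcard (SelRelQ W K c (insert q n) {q} μ).toAddSubgroup hA hy hz hz0'
  exact ⟨a, by rw [← hΦ y, ← hΦ z, ha]; exact map_zsmul Φ a _⟩

omit [Module (ZMod 3) (V3 W K)] in
/-- **(Line) from (H0)** (any number field `K`). The input (Line) of `Method2.selQ_rankLowering_on_of_localGlobal`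
VERBATIM — at the place `v` of a good unipotent-admissible `q`, the `torsionLocMap`-localisations of the classes
satisfying E's Kummer condition at `v` are the integer multiples of one local class — from (H0). Proof: the local
Kummer condition `𝓛_v ≤ H¹(K_v, E[3])` is isotropic for the local Weil cup product (Poonen–Rains, DISCHARGED in the
tree: `kummerClass_cupProduct_kummerClass_eq_zero_holds`) and `#H¹(K_v, E[3]) ≤ 9` by (H0), so `𝓛_v` is a line
(`exists_zsmul_of_weilIsotropic_of_card_le`); Bertolini–Darmon Lemma 2.6 ∕ koly MEMO-v2 U1 («`H¹_fin` is
one-dimensional») at `p = 3`. CONDITIONAL on (H0) only. [cite: BertoliniDarmon2005, Lemma 2.6]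
[cite: PoonenRains2012, Prop. 4.8 and Cor. 4.6] -/
theorem hline_of_h0
    (h0 : ∀ q : {q // IsUAdmissiblePrime W K q}, FrobSqNeOneAt W 3 q.1 →
      ∀ w : HeightOneSpectrum (𝓞 K), ((q : ℕ) : 𝓞 K) ∈ w.asIdeal →
        Nat.card (GaloisRep.restrictField (w.adicCompletion K)
          ((W.baseChange K).torsionGaloisModule ((3 ^ 1 : ℕ) : ℤ))).toTopRep.ρ.invariants ≤ 3) :
    ∀ (q : {q // IsUAdmissiblePrime W K q}) (v : HeightOneSpectrum (𝓞 K)), FrobSqNeOneAt W 3 q.1 →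
      ((q : ℕ) : 𝓞 K) ∈ v.asIdeal →
      ∃ ℓ, ∀ y ∈ selmerLocalKer (W.baseChange K) (v.adicCompletion K) ((3 ^ 1 : ℕ) : ℤ),
        ∃ a : ℤ, (W.baseChange K).torsionLocMap (v.adicCompletion K) ((3 ^ 1 : ℕ) : ℤ) y = a • ℓ := by
  intro q v hq hv
  haveI : Fact (Nat.Prime (3 ^ 1)) := ⟨by norm_num⟩
  haveI : PerfectField K := PerfectField.ofCharZero
  have h3Z : ((3 ^ 1 : ℕ) : ℤ) ≠ 0 := by norm_num
  obtain ⟨e, hμ, hadd₁, hadd₂, halt, hnondeg, hgal⟩ :=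
    exists_weilPairing_holds (W.baseChange K) (3 ^ 1) (by norm_num) (by norm_num)
  -- `v ∤ 3` (`q ≠ 3` is prime and `q ∈ v`)
  have h3v : ((3 ^ 1 : ℕ) : 𝓞 K) ∉ v.asIdeal := by
    intro h3
    have hcop : Nat.Coprime (q : ℕ) 3 :=
      (Nat.coprime_primes q.2.1 Nat.prime_three).mpr q.2.2.2.2.1
    obtain ⟨a, b, hab⟩ := (Nat.isCoprime_iff_coprime.mpr hcop : IsCoprime ((q : ℕ) : ℤ) (3 : ℤ))
    apply v.isPrime.ne_top
    rw [Ideal.eq_top_iff_one]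
    have h1 : (1 : 𝓞 K) = (a : 𝓞 K) * ((q : ℕ) : 𝓞 K) + (b : 𝓞 K) * ((3 ^ 1 : ℕ) : 𝓞 K) := by
      rw [pow_one]
      exact_mod_cast congrArg (fun t : ℤ => (t : 𝓞 K)) hab.symm
    rw [h1]
    exact v.asIdeal.add_mem (v.asIdeal.mul_mem_left _ hv) (v.asIdeal.mul_mem_left _ h3)
  -- `#H¹(K_v, E[3]) ≤ 9`, comparison map, and the (isotropic) local Kummer condition `𝓛_v`
  have hcard := natCard_galoisCohomology_one_torsion_le_sq (W.baseChange K) (3 ^ 1) v h3v (h0 q hq v hv)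
  obtain ⟨Φ, hΦ⟩ := exists_addMonoidHom_comp_localization_eq_torsionLocMap (W.baseChange K) (3 ^ 1) v
  have hisoL : ∀ x ∈ (W.baseChange K).kummerSelmerStructure ((3 ^ 1 : ℕ) : ℤ) (Sum.inr v),
      ∀ x' ∈ (W.baseChange K).kummerSelmerStructure ((3 ^ 1 : ℕ) : ℤ) (Sum.inr v),
      (weilContPairingLocal (W.baseChange K) (3 ^ 1) e hμ hadd₁ hadd₂ hgal (Sum.inr v)).cupProduct x x' = 0 :=
    fun x hx x' hx' ↦ (W.baseChange K).cupProduct_eq_zero_of_mem_kummerSelmerStructure_of_fact (3 ^ 1) e h3Z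
      (Sum.inr v) (kummerClass_cupProduct_kummerClass_eq_zero_holds _) hμ hadd₁ hadd₂ halt hgal hx hx'
  have hmemL : ∀ y ∈ selmerLocalKer (W.baseChange K) (v.adicCompletion K) ((3 ^ 1 : ℕ) : ℤ),
      galoisCohomology.localization ((W.baseChange K).torsionGaloisModule ((3 ^ 1 : ℕ) : ℤ)) (Sum.inr v) 1 y ∈
        (W.baseChange K).kummerSelmerStructure ((3 ^ 1 : ℕ) : ℤ) (Sum.inr v) := by
    intro y hy
    rw [← selmerLocalKer_completion_inr, ← comap_localization_kummerSelmerStructure] at hy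
    exact hy
  by_cases hex : ∃ z ∈ (W.baseChange K).kummerSelmerStructure ((3 ^ 1 : ℕ) : ℤ) (Sum.inr v), z ≠ 0
  · -- a non-zero Kummer class generates the (cyclic) Kummer line
    obtain ⟨z, hz, hz0⟩ := hex
    refine ⟨Φ z, fun y hy ↦ ?_⟩
    obtain ⟨a, ha⟩ := exists_zsmul_of_weilIsotropic_of_card_le (W.baseChange K) (3 ^ 1) e hμ hadd₁ hadd₂ hgal
      v hnondeg hcard _ hisoL hz hz0 (hmemL y hy)
    exact ⟨a, by rw [← hΦ y, ha]; exact map_zsmul Φ a z⟩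
  · -- the Kummer line is zero
    push Not at hex
    refine ⟨0, fun y hy ↦ ⟨0, ?_⟩⟩
    rw [← hΦ y, hex _ (hmemL y hy), zero_smul]
    exact map_zero Φ

/-- **(Iso), UNCONDITIONALLY at an imaginary quadratic `K`.** The input (Iso) of koly3a's reduction VERBATIM, with no
hypothesis beyond the frame's `IsImaginaryQuadratic K`: `hiso_of_h0` fed with the proved (H0)
(`natCard_invariants_le_three_of_frobSqNeOneAt`, sibling `…Method2LocalH0.lean`). W. Zhang's Prop. 5.4 at `p = 3`
for the canonical level-raised spaces of the method skeleton, in the kernel. [cite: WZhang2014, Prop. 5.4, §9 (9.1)–(9.2)]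
[cite: MilneADT2006, Ch. I, Thm. 4.10(b)] -/
theorem hiso (hK : IsImaginaryQuadratic K) :
    ∀ (n : Finset {q // IsUAdmissiblePrime W K q}) (q : {q // IsUAdmissiblePrime W K q}) (μ : Bool),
      GoodLevel W K n → FrobSqNeOneAt W 3 q.1 → q ∉ n →
      ∀ v : HeightOneSpectrum (𝓞 K), ((q : ℕ) : 𝓞 K) ∈ v.asIdeal →
      ∀ y ∈ SelRelQ W K c (insert q n) {q} μ, ∀ z ∈ SelRelQ W K c (insert q n) {q} μ,
        (W.baseChange K).torsionLocMap (v.adicCompletion K) ((3 ^ 1 : ℕ) : ℤ) z ≠ 0 →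
        ∃ a : ℤ, (W.baseChange K).torsionLocMap (v.adicCompletion K) ((3 ^ 1 : ℕ) : ℤ) y =
          a • (W.baseChange K).torsionLocMap (v.adicCompletion K) ((3 ^ 1 : ℕ) : ℤ) z :=
  hiso_of_h0 W K c hK fun q hq w hw ↦ natCard_invariants_le_three_of_frobSqNeOneAt W K hK q hq w hw

omit [Module (ZMod 3) (V3 W K)] in
/-- **(Line), UNCONDITIONALLY at an imaginary quadratic `K`.** The input (Line) of koly3a's reduction VERBATIM, with no
hypothesis beyond `IsImaginaryQuadratic K`: `hline_of_h0` fed with the proved (H0). Bertolini–Darmon Lemma 2.6 ∕ koly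
MEMO-v2 U1 («`H¹_fin(K_q, E[3])` is a line at a unipotent-admissible `q`»), in the kernel.
[cite: BertoliniDarmon2005, Lemma 2.6] [cite: PoonenRains2012, Prop. 4.8 and Cor. 4.6] -/
theorem hline (hK : IsImaginaryQuadratic K) :
    ∀ (q : {q // IsUAdmissiblePrime W K q}) (v : HeightOneSpectrum (𝓞 K)), FrobSqNeOneAt W 3 q.1 →
      ((q : ℕ) : 𝓞 K) ∈ v.asIdeal →
      ∃ ℓ, ∀ y ∈ selmerLocalKer (W.baseChange K) (v.adicCompletion K) ((3 ^ 1 : ℕ) : ℤ),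
        ∃ a : ℤ, (W.baseChange K).torsionLocMap (v.adicCompletion K) ((3 ^ 1 : ℕ) : ℤ) y = a • ℓ :=
  hline_of_h0 W K fun q hq w hw ↦ natCard_invariants_le_three_of_frobSqNeOneAt W K hK q hq w hw

/-- **`stub_levelRaisingAtThree` — the REGISTERED v2x text ((A1) on GOOD levels), VERBATIM — from (Cheb) + (Equiv)
+ (Trans) ALONE, frame-wise.** koly3a's five-input reduction `selQ_rankLowering_on_of_localGlobal` with the inputs
(Line) and (Iso) SUPPLIED by the kernel theorems `hline` ∕ `hiso` (the frame carries `IsImaginaryQuadratic K`): what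
remains of stub A is (Cheb) [sign-refined Čebotarev at `p = 3`, koly MEMO-v8 §4], (Equiv) [the sign of complex
conjugation on `H¹(K_q, E[3])`, MEMO-v8 §2(e)] and (Trans) [`H¹_fin ∩ H¹_ord = 0`, MEMO-v8 §2(c)] — the last two LOCAL
statements at ONE good unipotent-admissible prime. CONDITIONAL; the stub is not claimed; nothing is booked.
[cite: WZhang2014, Prop. 5.4, Lemma 7.3, §9 (9.1)–(9.3)] [cite: BertoliniDarmon2005, Lemma 2.6, Thm. 3.2] -/
theorem stub_levelRaisingAtThree_of_cheb_equiv_trans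
    (hLH : ∀ (W : WeierstrassCurve ℚ) [W.IsElliptic] [W.IsGloballyMinimal] [NeZero (W.conductorNorm ℤ)] (K : Type)
      [Field K] [NumberField K] (Dt : ModularParametrizationData W (W.conductorNorm ℤ)) (β : ℤ) (ι : K →+* ℂ),
      Summit.BirchSwinnertonDyer.Rank1Residual.ClassX11b W 3 → W.HasMultiplicativeReductionAtPrime 3 →
      Literature.NumberTheory.EllipticCurves.Rank1Residual.Surj W 3 →
      Literature.NumberTheory.EllipticCurves.Rank1Residual.Ram W 3 → ¬ 3 ∣ W.tamagawaProduct →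
      IsImaginaryQuadratic K → Odd (NumberField.discr K) → SatisfiesHeegnerHypothesis (W.conductorNorm ℤ) K →
      (W.quadraticTwist (NumberField.discr K : ℚ)).entireLFunction 1 ≠ 0 → NumberField.discr K ≠ -3 →
      (4 * (W.conductorNorm ℤ : ℤ)) ∣ β ^ 2 - NumberField.discr K → ¬ (3 : ℤ) ∣ Dt.c →
      ∀ (c : K ≃ₐ[ℚ] K), c ≠ 1 → ∀ [Module (ZMod 3) (V3 W K)],
      -- (Cheb)
      (∀ (n : Finset {q // IsUAdmissiblePrime W K q}) (μ : Bool) (x : V3 W K), GoodLevel W K n →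
        x ∈ SelQ W K c n μ → x ≠ 0 →
        ∃ q : {q // IsUAdmissiblePrime W K q}, q ∉ n ∧ FrobSqNeOneAt W 3 q.1 ∧ ∃ v : HeightOneSpectrum (𝓞 K),
          ((q : ℕ) : 𝓞 K) ∈ v.asIdeal ∧
            (W.baseChange K).torsionLocMap (v.adicCompletion K) ((3 ^ 1 : ℕ) : ℤ) x ≠ 0) ∧
      -- (Equiv)
      (∀ q : {q // IsUAdmissiblePrime W K q}, FrobSqNeOneAt W 3 q.1 → ∃ s : Bool,
        ∀ v : HeightOneSpectrum (𝓞 K), ((q : ℕ) : 𝓞 K) ∈ v.asIdeal → ∀ z : V3 W K,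
          (W.baseChange K).torsionLocMap (v.adicCompletion K) ((3 ^ 1 : ℕ) : ℤ) (conjAct W c ((3 ^ 1 : ℕ) : ℤ) z) =
            sgn s • (W.baseChange K).torsionLocMap (v.adicCompletion K) ((3 ^ 1 : ℕ) : ℤ) z) ∧
      -- (Trans)
      (∀ (q : {q // IsUAdmissiblePrime W K q}) (v : HeightOneSpectrum (𝓞 K)), FrobSqNeOneAt W 3 q.1 →
        ((q : ℕ) : 𝓞 K) ∈ v.asIdeal →
        ∀ y z : V3 W K, y ∈ selmerLocalKer (W.baseChange K) (v.adicCompletion K) ((3 ^ 1 : ℕ) : ℤ) →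
          z ∈ (W.baseChange K).ordinaryLocalKer (v.adicCompletion K) ((3 ^ 1 : ℕ) : ℤ) →
          (∃ a : ℤ, (W.baseChange K).torsionLocMap (v.adicCompletion K) ((3 ^ 1 : ℕ) : ℤ) z =
            a • (W.baseChange K).torsionLocMap (v.adicCompletion K) ((3 ^ 1 : ℕ) : ℤ) y) →
          (W.baseChange K).torsionLocMap (v.adicCompletion K) ((3 ^ 1 : ℕ) : ℤ) z = 0)) :
    ∀ (W : WeierstrassCurve ℚ) [W.IsElliptic] [W.IsGloballyMinimal] [NeZero (W.conductorNorm ℤ)] (K : Type)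
      [Field K] [NumberField K] (Dt : ModularParametrizationData W (W.conductorNorm ℤ)) (β : ℤ) (ι : K →+* ℂ),
      Summit.BirchSwinnertonDyer.Rank1Residual.ClassX11b W 3 → W.HasMultiplicativeReductionAtPrime 3 →
      Literature.NumberTheory.EllipticCurves.Rank1Residual.Surj W 3 →
      Literature.NumberTheory.EllipticCurves.Rank1Residual.Ram W 3 → ¬ 3 ∣ W.tamagawaProduct →
      IsImaginaryQuadratic K → Odd (NumberField.discr K) → SatisfiesHeegnerHypothesis (W.conductorNorm ℤ) K →
      (W.quadraticTwist (NumberField.discr K : ℚ)).entireLFunction 1 ≠ 0 → NumberField.discr K ≠ -3 →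
      (4 * (W.conductorNorm ℤ : ℤ)) ∣ β ^ 2 - NumberField.discr K → ¬ (3 : ℤ) ∣ Dt.c →
      ∀ (c : K ≃ₐ[ℚ] K), c ≠ 1 → ∀ [Module (ZMod 3) (V3 W K)],
      -- (A1) rank lowering at one new GOOD (non-scalar) unipotent-admissible prime, on good levels, (9.1)–(9.2)
      (∀ (n : Finset {q // IsUAdmissiblePrime W K q}) (μ : Bool) (x : V3 W K),
        GoodLevel W K n → x ∈ SelQ W K c n μ → x ≠ 0 →
        ∃ q : {q // IsUAdmissiblePrime W K q}, q ∉ n ∧ GoodLevel W K (insert q n) ∧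
          x ∉ SelQ W K c (insert q n) μ ∧
          SelQ W K c (insert q n) μ ≤ SelQ W K c n μ ∧
          finrank (ZMod 3) (SelQ W K c (insert q n) μ) + 1 = finrank (ZMod 3) (SelQ W K c n μ) ∧
          SelQ W K c (insert q n) (!μ) = SelQ W K c n (!μ)) := by
  intro W _ _ _ K _ _ Dt β ι hX hmult hsurj hram htam hK hodd hH hLt h3 hβ hc c hc1 _
  obtain ⟨hcheb, hequiv, htrans⟩ := hLH W K Dt β ι hX hmult hsurj hram htam hK hodd hH hLt h3 hβ hc c hc1
  exact selQ_rankLowering_on_of_localGlobal W K c hcheb hequiv (hline W K hK) htrans (hiso W K c hK)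

end Method2

end Summit.BirchSwinnertonDyer.Rank1Residual.X11b.Three.Koly.Method2.Iso

end
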